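import Summits.FinalStateConjecture.FinalStateConjecture.Theorems.EIHFluxBalanceInertialRecessionCalculus
import Summits.FinalStateConjecture.FinalStateConjecture.Theorems.EIHFluxBalanceInertialRecessionStubSlavingCOERLieKernel

/-!
# Route EIHFluxBalance — `InertialRecession` (E′), skeleton r13, stub `stub_firstOrderSlaving` (D),
# part 3: the first variation of a painted summand along a motion (every spin), size of the
# rest-frame first variation, and its pull-back to the lab

Helper file for the crux `stmt-FinalStateConjecture-17403` (E′), stub (D).

* `firstOrder_hasDerivAt_boostedKerrBilin_motion` (and the body-rate form `…_motion'`) — along a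
  motion `(Λ(s), c(s))`, `d/ds boostedKerrBilin (Λ s) (c s) M a x` at `s₀` is the pull-back by
  `S = Λ₀⁻¹` of the rest-frame first variation `∂_{Ay + d} g + g(A·, ·) + g(·, A·)` with
  `A = D ∘ Λ₀` (`D = d/ds Λ⁻¹`), `d = −S ċ`, `y = S(x − c₀)` (chain rule; the spin-zero case is
  `hasDerivAt_boostedKerrBilin_zero_spin_motion`). This is exactly the variation field of the
  momentum-coercivity statement (Bs).
* `firstOrder_norm_lie_le`, `firstOrder_hasFDerivAt_lie` — size of the rest-frame first variation
  and of its derivative in terms of `‖g − η‖`, `‖Dg‖`, `‖D²g‖` at the point, for `η`-skew `A`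
  (the `η`-parts of the `A`-terms cancel).
* `firstOrder_norm_bilinearComp_le`, `firstOrder_hasFDerivAt_pullback` — pull-back to the lab.

Elementary; no definitions, no named facts.
-/

set_option linter.dupNamespace false
set_option maxSynthPendingDepth 3

noncomputable section

open scoped Topology
open Filter Set Function Literature.Geometry.Lorentzian
  Summit.FinalStateConjecture.FinalStateConjecture.Theorems

namespace Summit.FinalStateConjecture.FinalStateConjecture.Theorems.SublinearIsFree.Slaving

/-! ### The first variation of a painted summand along a motion, every spin -/

section Motion

variable {Λ : ℝ → lorentzGroup} {c : ℝ → E4} {M a s₀ : ℝ} {D : E4 →L[ℝ] E4} {cdot : E4}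

/-- The painted summand as a pull-back: `boostedKerrBilin Λ c M a x = g(y)(S·, S·)`. [folklore] -/
theorem firstOrder_boostedKerrBilin_eq_bilinearComp (L : lorentzGroup) (c₀ : E4) (M a : ℝ) (x : E4) :
    boostedKerrBilin L c₀ M a x = (Kerr.bilin M a (poincareInv L c₀ x)).bilinearComp
      (((L : E4 ≃L[ℝ] E4).symm : E4 →L[ℝ] E4)) (((L : E4 ≃L[ℝ] E4).symm : E4 →L[ℝ] E4)) := by
  ext v w; rfl

/-- **The first variation of a painted Kerr–Schild summand along a motion, for every spin.** If
`s ↦ Λ(s)⁻¹` has derivative `D` and `c` has derivative `ċ` at `s₀`, and the rest-frame radius of `x`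
is positive, then with `S = Λ₀⁻¹`, `y = S(x − c₀)`:
`d/ds|_{s₀} boostedKerrBilin (Λ s) (c s) M a x = (∂_{D(x−c₀) − Sċ} g(y))(S·,S·) + g(y)(D·,S·) + g(y)(S·,D·)`
(chain rule through `g(y)(S·, S·)`; Kerr–Schild 1965, §2). [cite: KerrSchild1965, §2] -/
theorem firstOrder_hasDerivAt_boostedKerrBilin_motion
    (hΛ : HasDerivAt (fun s ↦ (((Λ s : E4 ≃L[ℝ] E4).symm : E4 →L[ℝ] E4))) D s₀)
    (hc : HasDerivAt c cdot s₀) {x : E4}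
    (hx : 0 < Kerr.radius a (poincareInv (Λ s₀) (c s₀) x)) :
    HasDerivAt (fun s ↦ boostedKerrBilin (Λ s) (c s) M a x)
      ((fderiv ℝ (Kerr.bilin M a) (poincareInv (Λ s₀) (c s₀) x)
          (D (x - c s₀) - (((Λ s₀ : E4 ≃L[ℝ] E4).symm : E4 →L[ℝ] E4)) cdot)).bilinearComp
          (((Λ s₀ : E4 ≃L[ℝ] E4).symm : E4 →L[ℝ] E4)) (((Λ s₀ : E4 ≃L[ℝ] E4).symm : E4 →L[ℝ] E4))
        + (Kerr.bilin M a (poincareInv (Λ s₀) (c s₀) x)).bilinearComp D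
          (((Λ s₀ : E4 ≃L[ℝ] E4).symm : E4 →L[ℝ] E4))
        + (Kerr.bilin M a (poincareInv (Λ s₀) (c s₀) x)).bilinearComp
          (((Λ s₀ : E4 ≃L[ℝ] E4).symm : E4 →L[ℝ] E4)) D) s₀ := by
  set S : ℝ → E4 →L[ℝ] E4 := fun s ↦ (((Λ s : E4 ≃L[ℝ] E4).symm : E4 →L[ℝ] E4)) with hS
  have hy : ∀ s, poincareInv (Λ s) (c s) x = S s (x - c s) := fun s ↦ rfl
  have hK : HasFDerivAt (Kerr.bilin M a) (fderiv ℝ (Kerr.bilin M a) (poincareInv (Λ s₀) (c s₀) x))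
      (poincareInv (Λ s₀) (c s₀) x) :=
    ((Kerr.contDiffAt_bilin M a hx (n := 1)).differentiableAt one_ne_zero).hasFDerivAt
  have hQ : HasDerivAt (fun s ↦ Kerr.bilin M a (S s (x - c s)))
      (fderiv ℝ (Kerr.bilin M a) (poincareInv (Λ s₀) (c s₀) x) (D (x - c s₀) - S s₀ cdot)) s₀ :=
    hK.comp_hasDerivAt_of_eq s₀ (hasDerivAt_restPoint_motion hΛ hc x) (hy s₀)
  have h1 := hQ.clm_comp hΛ
  have h2 : HasDerivAt (fun s ↦ (ContinuousLinearMap.compL ℝ E4 E4 ℝ).flip (S s))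
      ((ContinuousLinearMap.compL ℝ E4 E4 ℝ).flip D) s₀ :=
    ((ContinuousLinearMap.compL ℝ E4 E4 ℝ).flip).hasFDerivAt.comp_hasDerivAt s₀ hΛ
  have h3 := h2.clm_comp h1
  have hfun : (fun s ↦ boostedKerrBilin (Λ s) (c s) M a x) = fun s ↦
      ((ContinuousLinearMap.compL ℝ E4 E4 ℝ).flip (S s)).comp
        ((Kerr.bilin M a (S s (x - c s))).comp (S s)) := by
    funext s
    rw [firstOrder_boostedKerrBilin_eq_bilinearComp, bilinearComp_self_eq_comp]
    rfl
  rw [hfun]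
  refine h3.congr_deriv ?_
  ext v w
  simp only [add_apply, ContinuousLinearMap.comp_apply, ContinuousLinearMap.flip_apply,
    ContinuousLinearMap.compL_apply, ContinuousLinearMap.bilinearComp_apply, hy]
  ring

/-- **Body-rate form.** With `A = D ∘ Λ₀` (`η`-skew, `minkowski_skew_of_hasDerivAt_lorentz_symm`) and
`d = −Sċ`, the first variation of the painted summand at `s₀` is
`(∂_{Ay + d} g(y))(S·,S·) + g(y)(AS·, S·) + g(y)(S·, AS·)`, `y = Λ₀⁻¹(x − c₀)` — the variation field of
the momentum-coercivity statement (Bs) with `L = Λ₀` at the translated point. [cite: KerrSchild1965, §2] -/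
theorem firstOrder_hasDerivAt_boostedKerrBilin_motion'
    (hΛ : HasDerivAt (fun s ↦ (((Λ s : E4 ≃L[ℝ] E4).symm : E4 →L[ℝ] E4))) D s₀)
    (hc : HasDerivAt c cdot s₀) {x : E4}
    (hx : 0 < Kerr.radius a (poincareInv (Λ s₀) (c s₀) x)) :
    HasDerivAt (fun s ↦ boostedKerrBilin (Λ s) (c s) M a x)
      ((fderiv ℝ (Kerr.bilin M a) (poincareInv (Λ s₀) (c s₀) x)
          ((D.comp ((Λ s₀ : E4 ≃L[ℝ] E4) : E4 →L[ℝ] E4)) (poincareInv (Λ s₀) (c s₀) x) +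
            -((((Λ s₀ : E4 ≃L[ℝ] E4).symm : E4 →L[ℝ] E4)) cdot))).bilinearComp
          (((Λ s₀ : E4 ≃L[ℝ] E4).symm : E4 →L[ℝ] E4)) (((Λ s₀ : E4 ≃L[ℝ] E4).symm : E4 →L[ℝ] E4))
        + (Kerr.bilin M a (poincareInv (Λ s₀) (c s₀) x)).bilinearComp
          ((D.comp ((Λ s₀ : E4 ≃L[ℝ] E4) : E4 →L[ℝ] E4)).comp
            (((Λ s₀ : E4 ≃L[ℝ] E4).symm : E4 →L[ℝ] E4)))
          (((Λ s₀ : E4 ≃L[ℝ] E4).symm : E4 →L[ℝ] E4))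
        + (Kerr.bilin M a (poincareInv (Λ s₀) (c s₀) x)).bilinearComp
          (((Λ s₀ : E4 ≃L[ℝ] E4).symm : E4 →L[ℝ] E4))
          ((D.comp ((Λ s₀ : E4 ≃L[ℝ] E4) : E4 →L[ℝ] E4)).comp
            (((Λ s₀ : E4 ≃L[ℝ] E4).symm : E4 →L[ℝ] E4)))) s₀ := by
  have h := firstOrder_hasDerivAt_boostedKerrBilin_motion (M := M) hΛ hc hx
  have hDS : (D.comp ((Λ s₀ : E4 ≃L[ℝ] E4) : E4 →L[ℝ] E4)).comp
      (((Λ s₀ : E4 ≃L[ℝ] E4).symm : E4 →L[ℝ] E4)) = D := by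
    ext v; simp
  have hDy : (D.comp ((Λ s₀ : E4 ≃L[ℝ] E4) : E4 →L[ℝ] E4)) (poincareInv (Λ s₀) (c s₀) x) =
      D (x - c s₀) := by
    simp [poincareInv]
  rw [hDS, hDy, ← sub_eq_add_neg]
  exact h

end Motion

/-! ### Size of the rest-frame first variation for an `η`-skew rate -/

section LieBounds

variable {K : E4 → E4 →L[ℝ] E4 →L[ℝ] ℝ} {A : E4 →L[ℝ] E4} {y d : E4}

/-- **The `η`-parts of the `A`-terms cancel**: for `η`-skew `A`,
`g(A·,·) + g(·,A·) = (g − η)(A·,·) + (g − η)(·,A·)`. [folklore] -/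
theorem firstOrder_lieA_eq_sub (hA : ∀ u w : E4, Minkowski.bilin (A u) w + Minkowski.bilin u (A w) = 0)
    (Q : E4 →L[ℝ] E4 →L[ℝ] ℝ) :
    Q.comp A + (Q.flip.comp A).flip =
      (Q - Minkowski.bilin).comp A + ((Q - Minkowski.bilin).flip.comp A).flip := by
  ext v w
  have h := hA v w
  simp only [add_apply, ContinuousLinearMap.comp_apply, ContinuousLinearMap.flip_apply, sub_apply]
  linarith

/-- **Size of the rest-frame first variation.** For `η`-skew `A`:
`‖∂_{Ay+d} g + g(A·,·) + g(·,A·)‖ ≤ ‖Dg(y)‖ (‖A‖ ‖y‖ + ‖d‖) + 2 ‖g(y) − η‖ ‖A‖`. [folklore] -/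
theorem firstOrder_norm_lie_le (hA : ∀ u w : E4, Minkowski.bilin (A u) w + Minkowski.bilin u (A w) = 0) :
    ‖fderiv ℝ K y (A y + d) + (K y).comp A + ((K y).flip.comp A).flip‖ ≤
      ‖fderiv ℝ K y‖ * (‖A‖ * ‖y‖ + ‖d‖) + 2 * ‖K y - Minkowski.bilin‖ * ‖A‖ := by
  rw [add_assoc, firstOrder_lieA_eq_sub hA]
  have h1 : ‖fderiv ℝ K y (A y + d)‖ ≤ ‖fderiv ℝ K y‖ * (‖A‖ * ‖y‖ + ‖d‖) := by
    refine (ContinuousLinearMap.le_opNorm _ _).trans (mul_le_mul_of_nonneg_left ?_ (norm_nonneg _))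
    exact (norm_add_le _ _).trans (add_le_add (A.le_opNorm y) le_rfl)
  have h2 : ‖(K y - Minkowski.bilin).comp A‖ ≤ ‖K y - Minkowski.bilin‖ * ‖A‖ :=
    ContinuousLinearMap.opNorm_comp_le _ _
  have h3 : ‖((K y - Minkowski.bilin).flip.comp A).flip‖ ≤ ‖K y - Minkowski.bilin‖ * ‖A‖ := by
    rw [ContinuousLinearMap.opNorm_flip]
    refine (ContinuousLinearMap.opNorm_comp_le _ _).trans ?_
    rw [ContinuousLinearMap.opNorm_flip]
  calc _ ≤ ‖fderiv ℝ K y (A y + d)‖ + ‖(K y - Minkowski.bilin).comp A +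
        ((K y - Minkowski.bilin).flip.comp A).flip‖ := norm_add_le _ _
    _ ≤ ‖fderiv ℝ K y (A y + d)‖ + (‖(K y - Minkowski.bilin).comp A‖ +
        ‖((K y - Minkowski.bilin).flip.comp A).flip‖) := by gcongr; exact norm_add_le _ _
    _ ≤ _ := by linarith

/-- **Derivative of the rest-frame first variation.** If `g` is `C²` at `y` then
`y ↦ ∂_{Ay+d} g + g(A·,·) + g(·,A·)` has derivative
`v ↦ ∂_{Av} g + D²g(v)(Ay + d) + Dg(v)(A·,·) + Dg(v)(·,A·)` at `y`, of norm
`≤ ‖D²g(y)‖ (‖A‖‖y‖ + ‖d‖) + 3 ‖Dg(y)‖ ‖A‖`. [folklore] -/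
theorem firstOrder_hasFDerivAt_lie (hK : ContDiffAt ℝ 2 K y) (A : E4 →L[ℝ] E4) (d : E4) :
    ∃ L' : E4 →L[ℝ] E4 →L[ℝ] E4 →L[ℝ] ℝ,
      HasFDerivAt (fun y' ↦ fderiv ℝ K y' (A y' + d) + (K y').comp A + ((K y').flip.comp A).flip) L' y ∧
      ‖L'‖ ≤ ‖fderiv ℝ (fderiv ℝ K) y‖ * (‖A‖ * ‖y‖ + ‖d‖) + 3 * ‖fderiv ℝ K y‖ * ‖A‖ := by
  have hd1 : DifferentiableAt ℝ K y := hK.differentiableAt (by norm_num)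
  have hd2 : DifferentiableAt ℝ (fderiv ℝ K) y :=
    (hK.fderiv_right (m := 1) (by norm_num)).differentiableAt one_ne_zero
  -- the three pieces
  have hu : HasFDerivAt (fun y' : E4 ↦ A y' + d) A y := (A.hasFDerivAt).add_const d
  have h1 := hd2.hasFDerivAt.clm_apply hu
  set T₂ : (E4 →L[ℝ] E4 →L[ℝ] ℝ) →L[ℝ] (E4 →L[ℝ] E4 →L[ℝ] ℝ) :=
    ContinuousLinearMap.precomp (E4 →L[ℝ] ℝ) A with hT₂
  set T₃ : (E4 →L[ℝ] E4 →L[ℝ] ℝ) →L[ℝ] (E4 →L[ℝ] E4 →L[ℝ] ℝ) :=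
    (ContinuousLinearMap.compL ℝ E4 (E4 →L[ℝ] ℝ) (E4 →L[ℝ] ℝ)) (ContinuousLinearMap.precomp ℝ A)
    with hT₃
  have hT₂ap : ∀ Q : E4 →L[ℝ] E4 →L[ℝ] ℝ, T₂ Q = Q.comp A := fun Q ↦ rfl
  have hT₃ap : ∀ Q : E4 →L[ℝ] E4 →L[ℝ] ℝ, T₃ Q = (Q.flip.comp A).flip := fun Q ↦ by
    ext v w; rfl
  have h2 : HasFDerivAt (fun y' ↦ (K y').comp A) (T₂.comp (fderiv ℝ K y)) y := by
    have := T₂.hasFDerivAt.comp y hd1.hasFDerivAt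
    simpa only [Function.comp_def, hT₂ap] using this
  have h3 : HasFDerivAt (fun y' ↦ ((K y').flip.comp A).flip) (T₃.comp (fderiv ℝ K y)) y := by
    have := T₃.hasFDerivAt.comp y hd1.hasFDerivAt
    simpa only [Function.comp_def, hT₃ap] using this
  refine ⟨_, (h1.add h2).add h3, ?_⟩
  -- norms
  have nT₂ : ‖T₂‖ ≤ ‖A‖ := by
    refine ContinuousLinearMap.opNorm_le_bound _ (norm_nonneg _) fun Q ↦ ?_
    rw [hT₂ap, mul_comm]
    exact ContinuousLinearMap.opNorm_comp_le _ _
  have nT₃ : ‖T₃‖ ≤ ‖A‖ := by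
    refine ContinuousLinearMap.opNorm_le_bound _ (norm_nonneg _) fun Q ↦ ?_
    rw [hT₃ap, ContinuousLinearMap.opNorm_flip, mul_comm]
    refine (ContinuousLinearMap.opNorm_comp_le _ _).trans ?_
    rw [ContinuousLinearMap.opNorm_flip]
  have nA : 0 ≤ ‖A‖ := norm_nonneg _
  have n1 : ‖(fderiv ℝ K y).comp A + (fderiv ℝ (fderiv ℝ K) y).flip (A y + d)‖ ≤
      ‖fderiv ℝ K y‖ * ‖A‖ + ‖fderiv ℝ (fderiv ℝ K) y‖ * (‖A‖ * ‖y‖ + ‖d‖) := by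
    refine (norm_add_le _ _).trans (add_le_add (ContinuousLinearMap.opNorm_comp_le _ _) ?_)
    refine (ContinuousLinearMap.le_opNorm _ _).trans ?_
    rw [ContinuousLinearMap.opNorm_flip]
    refine mul_le_mul_of_nonneg_left ?_ (norm_nonneg _)
    exact (norm_add_le _ _).trans (add_le_add (A.le_opNorm y) le_rfl)
  have n2 : ‖T₂.comp (fderiv ℝ K y)‖ ≤ ‖A‖ * ‖fderiv ℝ K y‖ :=
    (ContinuousLinearMap.opNorm_comp_le _ _).trans (mul_le_mul_of_nonneg_right nT₂ (norm_nonneg _))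
  have n3 : ‖T₃.comp (fderiv ℝ K y)‖ ≤ ‖A‖ * ‖fderiv ℝ K y‖ :=
    (ContinuousLinearMap.opNorm_comp_le _ _).trans (mul_le_mul_of_nonneg_right nT₃ (norm_nonneg _))
  calc _ ≤ ‖(fderiv ℝ K y).comp A + (fderiv ℝ (fderiv ℝ K) y).flip (A y + d)‖ +
        ‖T₂.comp (fderiv ℝ K y)‖ + ‖T₃.comp (fderiv ℝ K y)‖ := norm_add₃_le
    _ ≤ _ := by nlinarith

end LieBounds

/-! ### Pull-back to the lab -/

/-- `‖Q(S·, S'·)‖ ≤ ‖Q‖ ‖S‖ ‖S'‖`. [folklore] -/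
theorem firstOrder_norm_bilinearComp_le (Q : E4 →L[ℝ] E4 →L[ℝ] ℝ) (S S' : E4 →L[ℝ] E4) :
    ‖Q.bilinearComp S S'‖ ≤ ‖Q‖ * ‖S‖ * ‖S'‖ := by
  refine ContinuousLinearMap.opNorm_le_bound _ (by positivity) fun v ↦ ?_
  refine ContinuousLinearMap.opNorm_le_bound _ (by positivity) fun w ↦ ?_
  rw [ContinuousLinearMap.bilinearComp_apply]
  calc ‖Q (S v) (S' w)‖ ≤ ‖Q‖ * ‖S v‖ * ‖S' w‖ := Q.le_opNorm₂ _ _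
    _ ≤ ‖Q‖ * (‖S‖ * ‖v‖) * (‖S'‖ * ‖w‖) := by
        gcongr <;> exact ContinuousLinearMap.le_opNorm _ _
    _ = ‖Q‖ * ‖S‖ * ‖S'‖ * ‖v‖ * ‖w‖ := by ring

/-- **Derivative of a pulled-back form field.** If `F` has derivative `L'` at `S(z − c)` then
`z ↦ F(S(z − c))(S·, S·)` has derivative `v ↦ (L'(Sv))(S·, S·)` at `z`, of norm `≤ ‖L'‖ ‖S‖³`.
[folklore] -/
theorem firstOrder_hasFDerivAt_pullback {F : E4 → E4 →L[ℝ] E4 →L[ℝ] ℝ}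
    {L' : E4 →L[ℝ] E4 →L[ℝ] E4 →L[ℝ] ℝ} (S : E4 →L[ℝ] E4) (c z : E4)
    (hF : HasFDerivAt F L' (S (z - c))) :
    ∃ V' : E4 →L[ℝ] E4 →L[ℝ] E4 →L[ℝ] ℝ,
      HasFDerivAt (fun z' ↦ (F (S (z' - c))).bilinearComp S S) V' z ∧
      (∀ v, V' v = (L' (S v)).bilinearComp S S) ∧ ‖V'‖ ≤ ‖L'‖ * ‖S‖ ^ 3 := by
  set T : (E4 →L[ℝ] E4 →L[ℝ] ℝ) →L[ℝ] (E4 →L[ℝ] E4 →L[ℝ] ℝ) :=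
    ((ContinuousLinearMap.compL ℝ E4 (E4 →L[ℝ] ℝ) (E4 →L[ℝ] ℝ))
      ((ContinuousLinearMap.compL ℝ E4 E4 ℝ).flip S)).comp
      (ContinuousLinearMap.precomp (E4 →L[ℝ] ℝ) S) with hT
  have hTap : ∀ Q : E4 →L[ℝ] E4 →L[ℝ] ℝ, T Q = Q.bilinearComp S S := fun Q ↦ by
    ext v w; rfl
  have haff : HasFDerivAt (fun z' : E4 ↦ S (z' - c)) S z := by
    have he : (fun z' : E4 ↦ S (z' - c)) = fun z' ↦ S z' - S c := funext fun z' ↦ map_sub S z' c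
    rw [he]
    exact S.hasFDerivAt.sub_const (S c)
  have hcomp : HasFDerivAt (fun z' ↦ F (S (z' - c))) (L'.comp S) z := hF.comp z haff
  have h := T.hasFDerivAt.comp z hcomp
  refine ⟨T.comp (L'.comp S), ?_, fun v ↦ ?_, ?_⟩
  · simpa only [Function.comp_def, hTap] using h
  · simp only [ContinuousLinearMap.comp_apply, hTap]
  · refine ContinuousLinearMap.opNorm_le_bound _ (by positivity) fun v ↦ ?_
    simp only [ContinuousLinearMap.comp_apply, hTap]
    calc ‖(L' (S v)).bilinearComp S S‖ ≤ ‖L' (S v)‖ * ‖S‖ * ‖S‖ :=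
          firstOrder_norm_bilinearComp_le _ _ _
      _ ≤ (‖L'‖ * (‖S‖ * ‖v‖)) * ‖S‖ * ‖S‖ := by
          gcongr
          exact (L'.le_opNorm _).trans (mul_le_mul_of_nonneg_left (S.le_opNorm v) (norm_nonneg _))
      _ = ‖L'‖ * ‖S‖ ^ 3 * ‖v‖ := by ring

/-- **The pulled-back first variation in the form of the momentum-coercivity statement (Bs).**
`(∂_u g + g(A·,·) + g(·,A·))(S·, S·) = (∂_u g)(S·,S·) + g(AS·, S·) + g(S·, AS·)`. [folklore] -/
theorem firstOrder_lie_bilinearComp_eq (Q Q' : E4 →L[ℝ] E4 →L[ℝ] ℝ) (A S : E4 →L[ℝ] E4) :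
    (Q' + Q.comp A + (Q.flip.comp A).flip).bilinearComp S S =
      Q'.bilinearComp S S + Q.bilinearComp (A.comp S) S + Q.bilinearComp S (A.comp S) := by
  ext v w
  simp

/-- **Registered one-line carrier form** (`firstOrder_variation_motion_D3`, stub (D) of the crux
item) of `firstOrder_hasDerivAt_boostedKerrBilin_motion'`. [cite: KerrSchild1965, §2] -/
theorem firstOrder_variation_motion_D3 : open Literature.Geometry.Lorentzian in ∀ {Λ : ℝ → lorentzGroup} {c : ℝ → E4} {M a s₀ : ℝ} {D : E4 →L[ℝ] E4} {cdot : E4}, HasDerivAt (fun s ↦ (((Λ s : E4 ≃L[ℝ] E4).symm : E4 →L[ℝ] E4))) D s₀ → HasDerivAt c cdot s₀ → ∀ {x : E4}, 0 < Kerr.radius a (poincareInv (Λ s₀) (c s₀) x) → HasDerivAt (fun s ↦ boostedKerrBilin (Λ s) (c s) M a x) ((fderiv ℝ (Kerr.bilin M a) (poincareInv (Λ s₀) (c s₀) x) ((D.comp ((Λ s₀ : E4 ≃L[ℝ] E4) : E4 →L[ℝ] E4)) (poincareInv (Λ s₀) (c s₀) x) + -((((Λ s₀ : E4 ≃L[ℝ]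 E4).symm : E4 →L[ℝ] E4)) cdot))).bilinearComp (((Λ s₀ : E4 ≃L[ℝ] E4).symm : E4 →L[ℝ] E4)) (((Λ s₀ : E4 ≃L[ℝ] E4).symm : E4 →L[ℝ] E4)) + (Kerr.bilin M a (poincareInv (Λ s₀) (c s₀) x)).bilinearComp ((D.comp ((Λ s₀ : E4 ≃L[ℝ] E4) : E4 →L[ℝ] E4)).comp (((Λ s₀ : E4 ≃L[ℝ] E4).symm : E4 →L[ℝ] E4))) (((Λ s₀ : E4 ≃L[ℝ] E4).symm : E4 →L[ℝ] E4)) + (Kerr.bilin M a (poincareInv (Λ s₀) (c s₀) x)).bilinearComp (((Λ s₀ : E4 ≃L[ℝ] E4).symm : E4 →L[ℝ] E4)) ((D.comp ((Λ s₀ : E4 ≃L[ℝ] E4) : E4 →L[ℝ] E4)).comp (((Λ s₀ : E4 ≃L[ℝ] E4).symm : E4 →L[ℝ] E4)))) s₀ :=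
  fun hΛ hc _ hx ↦ firstOrder_hasDerivAt_boostedKerrBilin_motion' hΛ hc hx

end Summit.FinalStateConjecture.FinalStateConjecture.Theorems.SublinearIsFree.Slaving

end
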